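import Summits.Ventures.HSemireg.WedgeHankelRecurrenceGaussZerosPerronBalance

/-!
# Venture HSemireg — **NEWTON'S METHOD FROM THE LEFT CONVERGES TO THE SMALLEST ZERO** (mirror of N350 by the reflection `X ↦ −X`): for `P = ∏ (X − x_j)` with increasing zeros and `ξ₀ < x_0` the
# Newton iterates increase to `x_0`, with `x_0 − ξ_n ≤ θⁿ (x_0 − ξ₀)`, `θ = c∕(1+c)`, `c = Σ_{i>0} (x_0 − ξ₀)∕(x_i − ξ₀)`

HONEST FRAMING. Part of the Lean index of the computation cell `pub-hsemireg` (seat p10 gen 45, Sunday typer «UNIFORM-IN-n»).  Real polynomials, finite sums and one geometric limit only; no variety,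
no cohomology theory, no sheaf, no Ext group and no semiregularity map is constructed here; nothing here says that HC / HC_CM / HC_AV holds; no Literature fact (unproved `Prop`) is declared or used.
Custodian versions as in `WedgeHankelSiegelIdeal` (1/3).
SOURCES (cited).  J. Stoer, R. Bulirsch, *Introduction to Numerical Analysis* (3rd ed.) §5.5 (Thm 5.5.5 and the remark on the smallest zero); A. M. Ostrowski, *Solution of Equations in Euclidean and
Banach Spaces* (1973) Ch. 9.
PROOF TYPED HERE.  The reflected polynomial `P̃ = ∏ (X − (−x_{t−k}))` satisfies `P̃(−y) = (−1)^{t+1} P(y)` and `P̃'(−y) = (−1)^t P'(y)`, so the Newton map commutes with `y ↦ −y`; N350 for `P̃`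
from `−ξ₀ > −x_0`.
DEDUP DISCLOSURE (`rg -n 'newton' Summits/Ventures/HSemireg`, 2026-09-03): N339 ∕ N350 treat the right of the largest zero only.  The 3 names below: 0 hits tree-wide.

WHAT IS IN THE TREE.  N350 `newton_iterates_mem`, `newton_iterates_geometric`, `newton_iterates_tendsto`; N324 `strictMono_neg_comp_rev`; Mathlib `Polynomial.derivative_comp`, `eval_comp`.
THIS FILE (namespace `Summit.Ventures.HSemireg.Wedge.HankelOuter` continued; CHAINED on N363 (import only); 0 definitions):
* §1129 `newton_map_reflect` (`P̃(−y) = (−1)^{t+1} P(y)`, `P̃'(−y) = (−1)^t P'(y)`, hence `−(y − P(y)∕P'(y)) = (−y) − P̃(−y)∕P̃'(−y)`), **`newton_iterates_left_mem`** (`ξ_n ≤ ξ_{n+1} ≤ x_0`),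
  **`newton_iterates_left_tendsto`** (`x_0 − ξ_n ≤ θⁿ (x_0 − ξ₀)` and `ξ_n → x_0`).
CAVEATS.  Exact arithmetic; starting point left of all zeros.  Nothing Ext-side.  New names only.
-/

open Module Polynomial Filter
open scoped Matrix Polynomial Topology

namespace Summit.Ventures.HSemireg.Wedge.HankelOuter

/-! ## §1129. Newton's method from the left -/

/-- **The reflected polynomial and the Newton map**: with `P = ∏ (X − x_j)` and `P̃ = ∏_k (X − (−x_{t−k}))`, `P̃(−y) = (−1)^{t+1} P(y)`, `P̃'(−y) = (−1)^t P'(y)`, and consequently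
`(−y) − P̃(−y)∕P̃'(−y) = −(y − P(y)∕P'(y))`. [bookkeeping; this file, §1129] -/
theorem newton_map_reflect {t : ℕ} (x : Fin (t + 1) → ℝ) (y : ℝ) :
    (∏ k : Fin (t + 1), (Polynomial.X - C (-x (Fin.rev k)))).eval (-y) = (-1) ^ (t + 1) * (∏ j, (Polynomial.X - C (x j))).eval y ∧
    (derivative (∏ k : Fin (t + 1), (Polynomial.X - C (-x (Fin.rev k))))).eval (-y) = (-1) ^ t * (derivative (∏ j, (Polynomial.X - C (x j)))).eval y ∧
    (-y) - (∏ k : Fin (t + 1), (Polynomial.X - C (-x (Fin.rev k)))).eval (-y) / (derivative (∏ k : Fin (t + 1), (Polynomial.X - C (-x (Fin.rev k))))).eval (-y) =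
      -(y - (∏ j, (Polynomial.X - C (x j))).eval y / (derivative (∏ j, (Polynomial.X - C (x j)))).eval y) := by
  -- `P̃ = (−1)^{t+1} · P ∘ (−X)`
  have hcomp : (∏ k : Fin (t + 1), (Polynomial.X - C (-x (Fin.rev k)))) = C ((-1 : ℝ) ^ (t + 1)) * (∏ j, (Polynomial.X - C (x j))).comp (-Polynomial.X) := by
    rw [Fintype.prod_equiv Fin.revPerm (fun k : Fin (t + 1) => Polynomial.X - C (-x (Fin.rev k))) (fun j => Polynomial.X - C (-x j)) (fun k => rfl), Polynomial.prod_comp]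
    have h1 : ∀ j : Fin (t + 1), (Polynomial.X - C (x j)).comp (-Polynomial.X) = (-1 : ℝ[X]) * (Polynomial.X - C (-x j)) := fun j => by
      rw [sub_comp, X_comp, C_comp, C_neg]; ring
    rw [Finset.prod_congr rfl fun j _ => h1 j, Finset.prod_mul_distrib, Finset.prod_const, Finset.card_univ, Fintype.card_fin, ← mul_assoc, map_pow, map_neg, map_one, ← pow_add,
      ← two_mul, pow_mul, neg_one_sq, one_pow, one_mul]
  have hev : (∏ k : Fin (t + 1), (Polynomial.X - C (-x (Fin.rev k)))).eval (-y) = (-1) ^ (t + 1) * (∏ j, (Polynomial.X - C (x j))).eval y := by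
    rw [hcomp]
    simp only [eval_mul, eval_C, eval_comp, eval_neg, eval_X, neg_neg]
  have hder : (derivative (∏ k : Fin (t + 1), (Polynomial.X - C (-x (Fin.rev k))))).eval (-y) = (-1) ^ t * (derivative (∏ j, (Polynomial.X - C (x j)))).eval y := by
    rw [hcomp, derivative_C_mul, Polynomial.derivative_comp, derivative_neg, derivative_X]
    simp only [eval_mul, eval_C, eval_comp, eval_neg, eval_X, eval_one, neg_neg]
    rw [pow_succ]
    ring
  refine ⟨hev, hder, ?_⟩
  rw [hev, hder, pow_succ]
  rcases eq_or_ne ((derivative (∏ j, (Polynomial.X - C (x j)))).eval y) 0 with h0 | h0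
  · rw [h0]; simp
  · have h1 : ((-1 : ℝ) ^ t) ≠ 0 := pow_ne_zero _ (by norm_num)
    field_simp
    ring

/-- **The Newton iterates from `ξ₀ < x_0` stay in `[ξ₀, x_0]` and increase.** [Stoer–Bulirsch §5.5; this file, §1129] -/
theorem newton_iterates_left_mem {P : ℝ[X]} {t : ℕ} {x : Fin (t + 1) → ℝ} (hx : StrictMono x) (hP : P = ∏ j, (Polynomial.X - C (x j)))
    {ξ : ℕ → ℝ} (hξ0 : ξ 0 < x 0) (hstep : ∀ n, ξ (n + 1) = ξ n - P.eval (ξ n) / (derivative P).eval (ξ n)) (n : ℕ) :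
    ξ n ≤ x 0 ∧ ξ 0 ≤ ξ n ∧ ξ n ≤ ξ (n + 1) := by
  have hxr := strictMono_neg_comp_rev hx
  have hrefl := fun y => (newton_map_reflect x y).2.2
  -- the reflected iterates
  have hstep' : ∀ n, (fun n => -ξ n) (n + 1) = (fun n => -ξ n) n - (∏ k : Fin (t + 1), (Polynomial.X - C (-x (Fin.rev k)))).eval ((fun n => -ξ n) n) /
      (derivative (∏ k : Fin (t + 1), (Polynomial.X - C (-x (Fin.rev k))))).eval ((fun n => -ξ n) n) := fun n => by
    dsimp only; rw [hrefl, hstep n, hP]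
  have h0' : (fun k : Fin (t + 1) => -x (Fin.rev k)) (Fin.last t) < (fun n => -ξ n) 0 := by simp only [Fin.rev_last]; linarith
  obtain ⟨h1, h2, h3⟩ := newton_iterates_mem (x := fun k : Fin (t + 1) => -x (Fin.rev k)) (P := ∏ k : Fin (t + 1), (Polynomial.X - C (-x (Fin.rev k)))) (ξ := fun n => -ξ n) hxr rfl h0' hstep' n
  simp only [Fin.rev_last] at h1 h2 h3
  exact ⟨by linarith, by linarith, by linarith⟩

/-- **NEWTON FROM THE LEFT CONVERGES TO THE SMALLEST ZERO: `x_0 − ξ_n ≤ θⁿ (x_0 − ξ₀)` with `θ = c∕(1+c)`, `c = Σ_{i ≠ 0} (x_0 − ξ₀)∕(x_i − ξ₀)`, and `ξ_n → x_0`.** [Stoer–Bulirsch Thm 5.5.5;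
this file, §1129] -/
theorem newton_iterates_left_tendsto {P : ℝ[X]} {t : ℕ} {x : Fin (t + 1) → ℝ} (hx : StrictMono x) (hP : P = ∏ j, (Polynomial.X - C (x j)))
    {ξ : ℕ → ℝ} (hξ0 : ξ 0 < x 0) (hstep : ∀ n, ξ (n + 1) = ξ n - P.eval (ξ n) / (derivative P).eval (ξ n)) :
    (∀ n, x 0 - ξ n ≤ ((∑ i ∈ Finset.univ.erase (0 : Fin (t + 1)), (x 0 - ξ 0) / (x i - ξ 0)) / (1 + ∑ i ∈ Finset.univ.erase (0 : Fin (t + 1)), (x 0 - ξ 0) / (x i - ξ 0))) ^ n * (x 0 - ξ 0)) ∧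
      Tendsto ξ atTop (𝓝 (x 0)) := by
  have hxr := strictMono_neg_comp_rev hx
  have hrefl := fun y => (newton_map_reflect x y).2.2
  have hstep' : ∀ n, (fun n => -ξ n) (n + 1) = (fun n => -ξ n) n - (∏ k : Fin (t + 1), (Polynomial.X - C (-x (Fin.rev k)))).eval ((fun n => -ξ n) n) /
      (derivative (∏ k : Fin (t + 1), (Polynomial.X - C (-x (Fin.rev k))))).eval ((fun n => -ξ n) n) := fun n => by
    dsimp only; rw [hrefl, hstep n, hP]
  have h0' : (fun k : Fin (t + 1) => -x (Fin.rev k)) (Fin.last t) < (fun n => -ξ n) 0 := by simp only [Fin.rev_last]; linarith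
  refine ⟨fun n => ?_, ?_⟩
  · have h := newton_iterates_geometric (x := fun k : Fin (t + 1) => -x (Fin.rev k)) (P := ∏ k : Fin (t + 1), (Polynomial.X - C (-x (Fin.rev k)))) (ξ := fun n => -ξ n) hxr rfl h0' hstep' n
    simp only [Fin.rev_last] at h
    -- the constant `c` is the same after the substitution `i ↦ rev i`
    obtain ⟨f, hf⟩ : ∃ f : Fin (t + 1) → ℝ, f = fun j => (x 0 - ξ 0) / (x j - ξ 0) := ⟨_, rfl⟩
    have hg : ∀ i : Fin (t + 1), (-ξ 0 - -x 0) / (-ξ 0 - -x (Fin.rev i)) = f (Fin.rev i) := fun i => by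
      rw [hf]; dsimp only; rw [show -ξ 0 - -x 0 = x 0 - ξ 0 by ring, show -ξ 0 - -x (Fin.rev i) = x (Fin.rev i) - ξ 0 by ring]
    have hc : ∑ i ∈ Finset.univ.erase (Fin.last t), (-ξ 0 - -x 0) / (-ξ 0 - -x (Fin.rev i)) = ∑ i ∈ Finset.univ.erase (0 : Fin (t + 1)), (x 0 - ξ 0) / (x i - ξ 0) := by
      rw [Finset.sum_congr rfl fun i _ => hg i, Finset.sum_erase_eq_sub (Finset.mem_univ _), Finset.sum_erase_eq_sub (Finset.mem_univ _), Fin.rev_last,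
        Fintype.sum_equiv Fin.revPerm (fun i => f (Fin.rev i)) f (fun i => rfl), hf]
    rw [hc] at h
    have e1 : -ξ n - -x 0 = x 0 - ξ n := by ring
    have e2 : -ξ 0 - -x 0 = x 0 - ξ 0 := by ring
    rw [e1, e2] at h
    exact h
  · have h := newton_iterates_tendsto (x := fun k : Fin (t + 1) => -x (Fin.rev k)) (P := ∏ k : Fin (t + 1), (Polynomial.X - C (-x (Fin.rev k)))) (ξ := fun n => -ξ n) hxr rfl h0' hstep'
    simp only [Fin.rev_last] at h
    have h2 := h.neg
    simpa using h2

end Summit.Ventures.HSemireg.Wedge.HankelOuter
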